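import Literature.NumberTheory.Automorphic.IdeleClassCharacterConjugate
import Literature.NumberTheory.Automorphic.IdeleNormGalConj
import Literature.NumberTheory.GaloisRepresentations.HeckeCharacterValueFieldProofs
import Literature.NumberTheory.GaloisRepresentations.HeckeCharacterFiniteIdeleValuesProofs
import Literature.NumberTheory.ComplexMultiplication.ComplexReflexField
import Literature.NumberTheory.ComplexMultiplication.CMTypeLattice
import Literature.NumberTheory.NumberFields.CMFieldCompositum
import HarnessLib

/-!
# The algebraic twist `μ^{alg} = μ · |·|_E^{-1/2}` of a unitary idele class character of odd ∞-type
# ([Liu21] §4.1, after Definition 4.3) and its field of values `M_μ` (Remark 4.4)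

Topic `NumberTheory/Automorphic`; namespace `Literature.NumberTheory.Automorphic` (grouping sub-namespace
`IdeleClassGroup` for the statements about characters `ψ : C_L →ₜ* S¹`).  Definitions with bodies and
theorems; **no named fact, no `sorry`** (D-0026).  Companion of `IdeleClassCharacterHecke` (the dictionary
`IdeleClassGroup.toHeckeCharacter` between the tree's unitary characters `C_L →ₜ* S¹` with ∞-type `e` and
`GaloisRepresentations.HeckeCharacter`), `IdeleClassCharacterConjugate` (`μ^c = μ ∘ c`, [Liu21] Remark 4.4
first sentence) and of the Weil-1956 file `GaloisRepresentations/HeckeCharacterValueFieldProofs` (the values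
of an algebraic Hecke character at the unramified places lie in one number field).

SOURCE.  Y. Liu, *Fourier–Jacobi cycles and arithmetic relative trace formula* (appendix by C. Li and
Y. Zhu), Camb. J. Math. **9** (2021), no. 1, 1–147 = arXiv:2102.11518 [Liu2021].  Quotations are from the
author's TeX source `FJcycle.tex` (arXiv e-print, md5 `6db49a74122d…`); the held extraction
`paper:arxiv-2102.11518` (chunk `p0018`, lines `L37–L51`) is the second locator.

AS PRINTED (§4.1, running text between Definition 4.3 and Remark 4.4, TeX ll. 1922–1927; p0018 L45–48):
"Now let `μ` be a conjugate symplectic automorphic character, which is not algebraic. We put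
`μ^{alg} ≔ μ · | |_E^{-1/2}`, which is then algebraic. Denote by `M_μ ⊆ ℂ` the subfield generated by values
`μ^{alg}(x)` for `x ∈ (𝔸_E^∞)^×`, which is a number field containing `M'_μ`."  **Remark 4.4** (ll. 1930–1933):
"It is clear that `μ^c` is conjugate symplectic of the same weight as `μ`. Moreover, we have `M_{μ^c} = M_μ`,
`M'_{μ^c} = M'_μ`, and that `Ψ_{μ^c}` is the opposite CM type of `Ψ_μ`."  Here (ll. 1908–1911) the component of
`μ` at `τ ∈ Φ_F` is `z ↦ arg(z)^{-𝔴_τ}` with `𝔴_τ` ODD for conjugate symplectic `μ` (Remark 4.2).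

WHAT IS HERE (over the tree's real carriers; `L` a number field, `ψ : IdeleClassGroup L →ₜ* Circle`).
* `normSqrtCharacter L : HeckeCharacter L` — the quasi-character `‖·‖^{1/2}` (`x ↦ √‖x‖_𝔸 ∈ ℝ_{>0} ⊂ ℂˣ`),
  with `normSqrtCharacter_mul_self : ‖·‖^{1/2} · ‖·‖^{1/2} = ‖·‖` (`GaloisRepresentations.HeckeCharacter.normCharacter`),
  unramified everywhere, `Aut(L)`-invariant (`galConj_normSqrtCharacter`, from `ideleNorm_unitsMap_galRingHom`).
* **`IdeleClassGroup.muAlg L ψ ≔ toHeckeCharacter L ψ · (‖·‖^{1/2})⁻¹`** = Liu's `μ^{alg} = μ·|·|^{-1/2}` for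
  `μ = ψ`; `|μ^{alg}(x)| = ‖x‖^{-1/2}` (`norm_muAlg_apply`), same ramification as `ψ`
  (`isUnramifiedAt_muAlg_iff`), `μ^{alg}(ϖ_v) = ψ(ϖ_v) · √N(v)` (`valueAtUniformizer_muAlg`), and
  **`(μ^c)^{alg} = (μ^{alg})^c`** (`muAlg_galConj`: `muAlg (galConj σ ψ) = HeckeCharacter.galConj σ (muAlg ψ)` for
  every `σ ∈ Aut(L|K)`).
* **"which is then algebraic"** — `hasInfinityType_muAlg`: on a totally complex `L`, if `ψ` has unitary ∞-type
  `e` (`IdeleClassGroup.HasInfinityType L ψ e`: `ψ|_{L_∞ˣ} = ∏_w (u_w/|u_w|)^{e_w}`) with every `e_w` odd, then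
  `μ^{alg}` has the (integral) infinity type `(p, q) = ((1 − e)/2, (1 + e)/2)` in the sense of
  `GaloisRepresentations.HeckeCharacter.HasInfinityType` (`μ^{alg}((x,1)) = ∏_w ι_w(x_w)^{-p_w} \bar{ι_w(x_w)}^{-q_w}`
  on all of `(L ⊗ ℝ)ˣ`), hence `IsAlgebraic` (`isAlgebraic_muAlg`); for a CM field and `ψ` conjugate symplectic
  the oddness is the tree's `IsConjugateSymplectic.odd` ([Liu21] Remark 4.2), giving
  `IsConjugateSymplectic.hasInfinityType_muAlg` / `.isAlgebraic_muAlg`.  For weight one (`e_w = ±1`) the type is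
  `ι_w^{-1}` at the places with `e_w = -1` and `\bar ι_w^{-1}` at those with `e_w = 1` (`hasInfinityType_muAlg_of_weight_one`),
  i.e. `z ↦ z^{-1}` through the embeddings of the CM type `Φ_μ` — the shape used in [Liu21] Theorem 4.15.
  The complex identity behind it (private helper `archUnitaryValue_mul_norm_zpow`) is `(z/|z|)^{b−a} |z|^{−(a+b)} = z^{−a} \bar z^{−b}`.
* **"M_μ … is a number field"**, in the form Weil's theorem takes in the tree
  (`IsAlgebraic.exists_intermediateField_valueAtUniformizer_mem`): there is ONE subfield `E ⊆ ℂ`, finite over `ℚ`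
  and containing every conjugate of `L`, with `μ^{alg}(ϖ_v) ∈ E` at every finite place `v` where `ψ` is unramified
  (`exists_numberField_valueAtUniformizer_muAlg_mem`, `IsConjugateSymplectic.exists_numberField_…`).
* Liu's literal `M_μ` as `IdeleClassGroup.muAlgValueField L ψ : Subfield ℂ` — the subfield generated by the values
  of `μ^{alg}` on the finite ideles `{x ∈ 𝕀_L | x_∞ = 1}` — with `valueAtUniformizer_muAlg_mem_muAlgValueField` and
  **Remark 4.4 `M_{μ^c} = M_μ`** as `muAlgValueField_galConj` (`σ` permutes the finite ideles; in particular for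
  `σ = c`, `muAlgValueField_galConj_complexConj`).
* **"which is a number field"** literally (§ 6): `M_μ` lies in Weil's number field of `μ^{alg}`
  (`exists_numberField_muAlgValueField_le`, from `HeckeCharacter.IsAlgebraic.exists_numberField_coe_apply_mem_of_fst_eq_one`
  of `GaloisRepresentations/HeckeCharacterFiniteIdeleValuesProofs`: the values of an algebraic Hecke character of a totally
  complex field on ALL finite ideles lie in Weil's field), hence `[M_μ : ℚ] < ∞` (`finiteDimensional_muAlgValueField`,
  `IsConjugateSymplectic.finiteDimensional_muAlgValueField`; also for `μ^c`).
* **"… containing `M'_μ`"** for WEIGHT ONE (§ 7): Liu's `M'_μ ⊆ ℂ`, the reflex field of `(E, Φ_μ)`, is the tree's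
  `ComplexMultiplication.traceField Φ_μ = ℚ(tr_Φ(x) | x)` (Shimura §8.3 Prop. 28, `ComplexReflexField`), and
  `traceField Φ_μ ≤ M_μ` (`traceField_le_muAlgValueField`, `HasCMType.traceField_le_muAlgValueField`,
  `IsConjugateSymplectic.traceField_le_and_finiteDimensional`): `μ^{alg}` of the finite part `(k)(k)_∞⁻¹` of a principal
  idele is the type norm `N_Φ(k) = ∏_{φ ∈ Φ} φ(k)` (`coe_muAlg_principal_finitePart_eq_typeNorm`), so `N_Φ(x + t) ∈ M_μ`
  for all `t ∈ ℕ`, and the polynomial `∏_φ (X + φ(x))` — with values in `M_μ` on `ℕ` — has its coefficients, among them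
  `tr_Φ(x)`, in `M_μ` (Lagrange interpolation at rational nodes, `cmTypeTrace_mem_muAlgValueField`).
* **"… containing `M'_μ`" for conjugate symplectic `μ` of ANY (odd) weight (§ 8)** — Liu's sentence in its printed
  generality: `traceField Φ_μ ≤ M_μ` (`traceField_le_muAlgValueField_of_odd`,
  `IsConjugateSymplectic.traceField_le_muAlgValueField`, `IsConjugateSymplectic.traceField_le_and_finiteDimensional'`).
  Here `μ^{alg}((k)^∞)` is the generalised type norm `∏_φ φ(k)^{(1−ε_φ)/2}` (`ε_φ = exponentAt e φ = ∓𝔴`;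
  `coe_muAlg_principal_finitePart_eq_prod_zpow`), so `∏_φ φ(y)^{s+(1−ε_φ)/2} = μ^{alg}((y)^∞)^{s+1} μ^{alg}((\bar y)^∞)^s ∈ M_μ`
  (`prod_embeddings_zpow_mem_muAlgValueField`); and a subfield `M ⊆ ℂ` containing such products — exponents `≥ 0`,
  `> s` exactly on `Φ` — contains the reflex field (`traceField_le_of_forall_prod_zpow_mem`): in the Galois closure
  `Ω ⊆ ℂ` of `E` (`normalClosure ℚ E ℂ`, Galois by `NumberFields.CMFieldCompositum.isGalois_normalClosure_complex`) an
  automorphism fixing `M ∩ Ω` fixes the polynomial `∏_φ (X − φ(k))^{n_φ}` (`k` a primitive element; coefficients in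
  `M` by Lagrange), hence preserves the multiplicities of its distinct roots `φ(k)`, hence stabilises `Φ`, so
  `K* = Ω^{Stab Φ} ⊆ M` (`ComplexMultiplication.reflexField`, `map_reflexField_algValuedIn`).

NOT HERE.  (i) The reflex-side clauses `M'_{μ^c} = M'_μ`, `Ψ_{μ^c} = \bar Ψ_μ` of Remark 4.4 (generic CM-type
statements: `ComplexMultiplication/ReflexOfConjugateType`, `traceField_bar`, `reflexCMType_bar`).  (ii) Nothing about `μ^{alg}` for
characters with an even exponent (there `μ·|·|^{-1/2}` is not algebraic; Liu only twists conjugate symplectic `μ`).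
(iii) Fields with a real place (Liu's `E` is CM, hence totally complex).
No statement is weakened: every theorem below is an instance of the printed sentences for the tree's carriers.

## References

* [Liu2021] Y. Liu, *Fourier–Jacobi cycles and arithmetic relative trace formula*, Camb. J. Math. 9 (2021), no. 1,
  1–147, arXiv:2102.11518 — §4.1, text after Def. 4.3 (TeX ll. 1922–1927) and Remark 4.4 (ll. 1930–1933).
* [Weil1956] A. Weil, *On a certain type of characters of the idèle-class group of an algebraic number-field*,
  Proc. Int. Symp. Tokyo–Nikko 1955 (1956), 1–7, §1 (type `A₀`; values in a number field).
* [TateThesis1967] J. Tate, *Fourier analysis in number fields and Hecke's zeta-functions*, in Cassels–Fröhlich,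
  *Algebraic Number Theory* (1967), Ch. XV §4.3 (the quasi-characters `|𝔞|^s`).
* [CasselsFrohlichANT1967] J. W. S. Cassels, A. Fröhlich (eds.), *Algebraic Number Theory* (1967), Ch. VII §1.1
  (`|σ a|_{σ w} = |a|_w`).
* [Shimura1998] G. Shimura, *Abelian Varieties with Complex Multiplication and Modular Functions* (1998), §8.3
  Prop. 28 (`K* = ℚ(∑ᵢ ξ^{φᵢ})`).
-/

set_option autoImplicit false

noncomputable section

open scoped NNReal ComplexConjugate
open NumberField IsDedekindDomain NumberField.InfinitePlace NumberField.InfinitePlace.Completion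

namespace Literature.NumberTheory.Automorphic

open GaloisRepresentations

/-! ## § 0. The complex identity `(z/|z|)^{b-a} · |z|^{-(a+b)} = z^{-a} \bar z^{-b}` -/

/-- **The complex identity behind the infinity type of `μ^{alg}`**: for `z ≠ 0` and all integers `a, b`,
`(z/|z|)^{b−a} · |z|^{−(a+b)} = z^{−a} \bar z^{−b}` (since `\bar z = |z|² z⁻¹`).  Companion of the tree's
`HeckeCharacter.archUnitaryValue_mul_normSq_zpow` (the case `a + b` even, phrased with `|z|²`). [folklore] -/
private theorem archUnitaryValue_mul_norm_zpow {z : ℂ} (hz : z ≠ 0) (a b : ℤ) :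
    archUnitaryValue (b - a) 0 z * ((‖z‖ : ℝ) : ℂ) ^ (-(a + b)) = z ^ (-a) * conj z ^ (-b) := by
  have hr : ((‖z‖ : ℝ) : ℂ) ≠ 0 := Complex.ofReal_ne_zero.2 (norm_ne_zero_iff.2 hz)
  have hconj : conj z = ((‖z‖ : ℝ) : ℂ) ^ (2 : ℤ) * z⁻¹ := by
    rw [zpow_ofNat, ← Complex.mul_conj', mul_comm z, mul_assoc, mul_inv_cancel₀ hz, mul_one]
  unfold archUnitaryValue
  rw [Complex.ofReal_zero, zero_mul, Complex.cpow_zero, mul_one, hconj, mul_zpow, ← zpow_mul,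
    inv_zpow', div_zpow, div_eq_mul_inv, ← zpow_neg, neg_neg]
  calc z ^ (b - a) * ((‖z‖ : ℝ) : ℂ) ^ (-(b - a)) * ((‖z‖ : ℝ) : ℂ) ^ (-(a + b))
      = z ^ (b - a) * ((‖z‖ : ℝ) : ℂ) ^ (-(b - a) + -(a + b)) := by rw [mul_assoc, ← zpow_add₀ hr]
    _ = z ^ (-a + b) * ((‖z‖ : ℝ) : ℂ) ^ (2 * -b) := by
        rw [show -(b - a) + -(a + b) = 2 * -b by ring, show b - a = -a + b by ring]
    _ = z ^ (-a) * (((‖z‖ : ℝ) : ℂ) ^ (2 * -b) * z ^ b) := by rw [zpow_add₀ hz]; ring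

/-! ## § 1. The quasi-character `‖·‖^{1/2}` -/

section NormSqrt

variable (K : Type) [Field K] [NumberField K]

/-- **The square root of the norm character**, `‖·‖^{1/2} : 𝕀_K →ₜ* ℂˣ`, `x ↦ √‖x‖_𝔸` (the idelic norm
`ideleNormUnits K : 𝕀_K →* ℝ_{>0}`, the square root on `ℝ_{>0}` (`NNReal.sqrtHom`) and the inclusion
`ℝ_{>0} ↪ ℂˣ`), as a Hecke character: continuous, and trivial on `Kˣ` by the product formula.  It is the
quasi-character `|𝔞|^{1/2}` of Tate's thesis (§4.3: the quasi-characters trivial on `𝕀¹_K` are the `|𝔞|^s`), the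
twist in Liu's `μ^{alg} = μ · |·|_E^{-1/2}`. [cite: TateThesis1967, §4.3, p. 339] -/
def normSqrtCharacter : HeckeCharacter K where
  toContinuousMonoidHom :=
    { toMonoidHom :=
        (Units.map ((((Complex.ofRealHom : ℝ →+* ℂ).toMonoidHom.comp NNReal.toRealHom.toMonoidHom).comp
          (NNReal.sqrtHom : ℝ≥0 →*₀ ℝ≥0).toMonoidHom))).comp (ideleNormUnits K)
      continuous_toFun := by
        refine (Continuous.units_map _ ?_).comp ?_
        · exact (Complex.continuous_ofReal.comp NNReal.continuous_coe).comp NNReal.continuous_sqrt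
        · exact Units.continuous_iff.mpr ⟨continuous_ideleNorm_holds K,
            ((continuous_ideleNorm_holds K).comp continuous_inv).congr fun _ => rfl⟩ }
  map_principal' x hx := by
    refine Units.ext ?_
    change (((NNReal.sqrt (IdeleClassGroup.ideleNorm K x) : ℝ≥0) : ℝ) : ℂ) = 1
    rw [ideleNorm_principal hx, NNReal.sqrt_one, NNReal.coe_one, Complex.ofReal_one]

/-- `‖·‖^{1/2}(x) = √‖x‖ ∈ ℝ ⊂ ℂ` (the tree's real-valued `GaloisRepresentations.ideleNorm`).
[cite: TateThesis1967, §4.3, p. 339] -/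
@[simp] theorem normSqrtCharacter_apply (x : ideleGroup K) :
    ((normSqrtCharacter K x : ℂˣ) : ℂ) = ((Real.sqrt (GaloisRepresentations.ideleNorm x) : ℝ) : ℂ) := by
  rw [← coe_ideleNorm, ← Real.coe_sqrt]
  rfl

/-- `|‖x‖^{1/2}| = √‖x‖`. [cite: TateThesis1967, §4.3, p. 339] -/
theorem norm_normSqrtCharacter_apply (x : ideleGroup K) :
    ‖((normSqrtCharacter K x : ℂˣ) : ℂ)‖ = Real.sqrt (GaloisRepresentations.ideleNorm x) := by
  rw [normSqrtCharacter_apply, Complex.norm_real, Real.norm_eq_abs, abs_of_nonneg (Real.sqrt_nonneg _)]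

/-- **`‖·‖^{1/2} · ‖·‖^{1/2} = ‖·‖`** (the tree's `HeckeCharacter.normCharacter`). [cite: TateThesis1967, §4.3, p. 339] -/
theorem normSqrtCharacter_mul_self : normSqrtCharacter K * normSqrtCharacter K = HeckeCharacter.normCharacter K :=
  HeckeCharacter.ext fun x => Units.ext (by
    have h0 : 0 ≤ GaloisRepresentations.ideleNorm x := by rw [← coe_ideleNorm]; exact NNReal.coe_nonneg _
    rw [HeckeCharacter.mul_apply, Units.val_mul, normSqrtCharacter_apply, HeckeCharacter.normCharacter_apply,
      ← Complex.ofReal_mul, Real.mul_self_sqrt h0])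

/-- `‖·‖^{1/2}` is unramified everywhere (`‖u‖ = 1` on `𝒪_vˣ`). [cite: TateThesis1967, §2.3] -/
theorem isUnramifiedAt_normSqrtCharacter (v : HeightOneSpectrum (𝓞 K)) :
    (normSqrtCharacter K).IsUnramifiedAt v := fun u => Units.ext (by
  rw [HeckeCharacter.localComponent_apply, normSqrtCharacter_apply, ideleNorm_localUnits_unitsMap,
    Real.sqrt_one, Complex.ofReal_one, Units.val_one])

/-- **`‖·‖^{1/2}(ϖ_v) = N(v)^{-1/2}`** (`‖ϖ_v‖_v = N(v)⁻¹`). [cite: TateThesis1967, §4.3] -/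
theorem valueAtUniformizer_normSqrtCharacter (v : HeightOneSpectrum (𝓞 K)) :
    (normSqrtCharacter K).valueAtUniformizer v = ((Real.sqrt ((Ideal.absNorm v.asIdeal : ℕ) : ℝ) : ℂ))⁻¹ := by
  rw [HeckeCharacter.valueAtUniformizer, HeckeCharacter.localComponent_apply, normSqrtCharacter_apply,
    ideleNorm_localUnits, HeckeCharacter.norm_uniformizer', Real.sqrt_inv, Complex.ofReal_inv]

variable {K}

/-- **The idele norm is `Aut(K)`-invariant**, `‖σ • x‖ = ‖x‖`, for the action of `σ ∈ Aut(K|F₀)` on `𝕀_K` used by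
`HeckeCharacter.galConj` (restatement of the tree's `ideleNorm_unitsMap_galRingHom` for the `•`-spelling).
[cite: CasselsFrohlichANT1967, Ch. VII §1.1] -/
theorem ideleNorm_galSMul {F₀ : Type} [Field F₀] [Algebra F₀ K] (σ : K ≃ₐ[F₀] K) (x : ideleGroup K) :
    GaloisRepresentations.ideleNorm (σ • x) = GaloisRepresentations.ideleNorm x := by
  have h : σ • x = Units.map (MulSemiringAction.toRingHom (K ≃ₐ[F₀] K) (AdeleRing (𝓞 K) K) σ :
      AdeleRing (𝓞 K) K →* AdeleRing (𝓞 K) K) x := Units.ext rfl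
  rw [h]
  exact ideleNorm_unitsMap_galRingHom F₀ σ x

variable (K) in
/-- **`‖·‖^{1/2} ∘ σ = ‖·‖^{1/2}`** for `σ ∈ Aut(K|F₀)`. [cite: CasselsFrohlichANT1967, Ch. VII §1.1] -/
theorem galConj_normSqrtCharacter {F₀ : Type} [Field F₀] [Algebra F₀ K] (σ : K ≃ₐ[F₀] K) :
    HeckeCharacter.galConj σ (normSqrtCharacter K) = normSqrtCharacter K :=
  HeckeCharacter.ext fun x => Units.ext (by
    rw [HeckeCharacter.galConj_apply, normSqrtCharacter_apply, normSqrtCharacter_apply, ideleNorm_galSMul])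

end NormSqrt

namespace IdeleClassGroup

/-! ## § 2. `μ^{alg} = μ · |·|^{-1/2}` ([Liu21] §4.1, l. 1922) -/

section MuAlg

variable (L : Type) [Field L] [NumberField L]

/-- **Liu's algebraic twist `μ^{alg} ≔ μ · |·|_E^{-1/2}`** of a continuous unitary idele class character
`μ = ψ : C_L →ₜ* S¹`, as a Hecke character `𝕀_L →ₜ* ℂˣ` (`toHeckeCharacter ψ · (‖·‖^{1/2})⁻¹`).  For `ψ`
conjugate symplectic (odd ∞-type) this is an ALGEBRAIC Hecke character (`IsConjugateSymplectic.isAlgebraic_muAlg`).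
[cite: Liu2021, §4.1, display after Def. 4.3 (TeX l. 1922)] -/
def muAlg (ψ : IdeleClassGroup L →ₜ* Circle) : HeckeCharacter L :=
  toHeckeCharacter L ψ * (normSqrtCharacter L)⁻¹

/-- `μ^{alg}(x) = μ[x] · (√‖x‖)⁻¹`. [cite: Liu2021, §4.1 (l. 1922)] -/
theorem coe_muAlg_apply (ψ : IdeleClassGroup L →ₜ* Circle) (x : ideleGroup L) :
    ((muAlg L ψ x : ℂˣ) : ℂ) =
      (ψ (x : IdeleClassGroup L) : ℂ) * (((Real.sqrt (GaloisRepresentations.ideleNorm x) : ℝ) : ℂ))⁻¹ := by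
  rw [muAlg, HeckeCharacter.mul_apply, HeckeCharacter.inv_apply, Units.val_mul, Units.val_inv_eq_inv_val,
    coe_toHeckeCharacter_apply, normSqrtCharacter_apply]

/-- `μ^{alg} · |·|^{1/2} = μ`. [cite: Liu2021, §4.1 (l. 1922)] -/
theorem muAlg_mul_normSqrtCharacter (ψ : IdeleClassGroup L →ₜ* Circle) :
    muAlg L ψ * normSqrtCharacter L = toHeckeCharacter L ψ := by
  rw [muAlg, inv_mul_cancel_right]

/-- **`|μ^{alg}(x)| = ‖x‖^{-1/2}`**: `μ^{alg}` is not unitary — "`μ` … which is not algebraic; … `μ^{alg}`, which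
is then algebraic": one trades unitarity for algebraicity. [cite: Liu2021, §4.1 (l. 1922)] -/
theorem norm_muAlg_apply (ψ : IdeleClassGroup L →ₜ* Circle) (x : ideleGroup L) :
    ‖((muAlg L ψ x : ℂˣ) : ℂ)‖ = (Real.sqrt (GaloisRepresentations.ideleNorm x))⁻¹ := by
  rw [coe_muAlg_apply, norm_mul, Circle.norm_coe, one_mul, norm_inv, Complex.norm_real, Real.norm_eq_abs,
    abs_of_nonneg (Real.sqrt_nonneg _)]

/-- `μ^{alg}` and `μ` have the same ramification (`‖·‖^{1/2}` is unramified everywhere).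
[cite: Liu2021, §4.1 (l. 1922)] -/
theorem isUnramifiedAt_muAlg_iff (ψ : IdeleClassGroup L →ₜ* Circle) (v : HeightOneSpectrum (𝓞 L)) :
    (muAlg L ψ).IsUnramifiedAt v ↔ (toHeckeCharacter L ψ).IsUnramifiedAt v := by
  constructor
  · intro h
    rw [← muAlg_mul_normSqrtCharacter]
    exact h.mul' (isUnramifiedAt_normSqrtCharacter L v)
  · intro h
    exact h.mul' (isUnramifiedAt_normSqrtCharacter L v).inv'

/-- **`μ^{alg}(ϖ_v) = μ(ϖ_v) · √N(v)`**. [cite: Liu2021, §4.1 (l. 1922)] -/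
theorem valueAtUniformizer_muAlg (ψ : IdeleClassGroup L →ₜ* Circle) (v : HeightOneSpectrum (𝓞 L)) :
    (muAlg L ψ).valueAtUniformizer v =
      (toHeckeCharacter L ψ).valueAtUniformizer v * ((Real.sqrt ((Ideal.absNorm v.asIdeal : ℕ) : ℝ) : ℂ)) := by
  rw [muAlg, HeckeCharacter.valueAtUniformizer_mul', HeckeCharacter.valueAtUniformizer_inv',
    valueAtUniformizer_normSqrtCharacter, inv_inv]

variable {L}

/-- **`(μ ∘ σ)^{alg} = μ^{alg} ∘ σ`** for `σ ∈ Aut(L|K)` — with `σ = c` on a CM field: `(μ^c)^{alg} = (μ^{alg})^c`,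
the identity behind Remark 4.4's `M_{μ^c} = M_μ` (`‖σ x‖ = ‖x‖` and `toHeckeCharacter_galConj`).
[cite: Liu2021, Remark 4.4 (ll. 1930–1933)] -/
theorem muAlg_galConj {K : Type} [Field K] [Algebra K L] (σ : L ≃ₐ[K] L) (ψ : IdeleClassGroup L →ₜ* Circle) :
    muAlg L (galConj σ ψ) = HeckeCharacter.galConj σ (muAlg L ψ) := by
  rw [muAlg, muAlg, toHeckeCharacter_galConj, HeckeCharacter.galConj_mul, HeckeCharacter.galConj_inv,
    galConj_normSqrtCharacter]

end MuAlg

/-! ## § 3. "which is then algebraic": the infinity type of `μ^{alg}` -/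

section InfinityType

variable {L : Type} [Field L] [NumberField L]

omit [NumberField L] in
/-- On a totally complex field every infinite place has local degree `[L_w : ℝ] = 2`. [folklore] -/
private theorem mult_eq_two [IsTotallyComplex L] (w : InfinitePlace L) : w.mult = 2 := by
  rw [NumberField.InfinitePlace.mult, if_neg (not_isReal_iff_isComplex.2 (IsTotallyComplex.isComplex w))]

/-- **`μ^{alg}` is algebraic, of infinity type `((1−e)/2, (1+e)/2)`** ([Liu21] "which is then algebraic").  Let `L`
be totally complex and let `ψ : C_L →ₜ* S¹` have unitary ∞-type `e` (`ψ((u,1)) = ∏_w (ι_w u_w/|ι_w u_w|)^{e_w}` on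
`L_∞ˣ`) with every `e_w` odd.  Then on ALL of `(L ⊗ ℝ)ˣ`,
`μ^{alg}((x, 1)) = ∏_w ι_w(x_w)^{-(1-e_w)/2} \overline{ι_w(x_w)}^{-(1+e_w)/2}`, i.e. `μ^{alg} = ψ · ‖·‖^{-1/2}` has the
integral infinity type `(p, q) = ((1−e)/2, (1+e)/2)` (`p_w + q_w = 1`, `q_w − p_w = e_w`): at a complex place
`(z/|z|)^{e} · |z|^{-1} = z^{(e−1)/2} \bar z^{−(e+1)/2}` (`archUnitaryValue_mul_norm_zpow`; `‖(x,1)‖ = ∏_w |ι_w x_w|²`).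
In Liu's normalisation (`μ_τ(z) = arg(z)^{−𝔴_τ}`, `e = −𝔴`) this is the type `z^{−(𝔴+1)/2} \bar z^{(𝔴−1)/2}`.
[cite: Liu2021, §4.1, after Def. 4.3 (TeX ll. 1922–1926)] -/
theorem hasInfinityType_muAlg [IsTotallyComplex L] {ψ : IdeleClassGroup L →ₜ* Circle} {e : InfinitePlace L → ℤ}
    (he : HasInfinityType L ψ e) (hodd : ∀ w, Odd (e w)) :
    (muAlg L ψ).HasInfinityType (fun w => (1 - e w) / 2) (fun w => (1 + e w) / 2) := by
  refine ⟨Set.univ, Filter.univ_mem, fun x _ => ?_⟩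
  have harch := ((hasUnitaryArchType_toHeckeCharacter_iff L ψ e).mpr he) x
  rw [muAlg, HeckeCharacter.mul_apply, HeckeCharacter.inv_apply, Units.val_mul, Units.val_inv_eq_inv_val, harch,
    normSqrtCharacter_apply, HeckeCharacter.ideleNorm_infiniteIdeles', HeckeCharacter.archFactor_apply]
  simp_rw [mult_eq_two]
  rw [Finset.prod_pow, Real.sqrt_sq (Finset.prod_nonneg fun w _ => norm_nonneg _), Complex.ofReal_prod,
    ← Finset.prod_inv_distrib, ← Finset.prod_mul_distrib]
  refine Finset.prod_congr rfl fun w _ => ?_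
  have hz : extensionEmbedding w ((x : InfiniteAdeleRing L) w) ≠ 0 := InfiniteIdele.extensionEmbedding_apply_ne_zero x w
  rw [← (isometry_extensionEmbedding w).norm_map_of_map_zero (map_zero _) ((x : InfiniteAdeleRing L) w)]
  obtain ⟨k, hk⟩ := hodd w
  have ha : (1 - e w) / 2 = -k := by rw [hk]; omega
  have hb : (1 + e w) / 2 = k + 1 := by rw [hk]; omega
  have key := archUnitaryValue_mul_norm_zpow hz (-k) (k + 1)
  rw [show k + 1 - -k = e w by rw [hk]; ring, show -(-k + (k + 1)) = (-1 : ℤ) by ring, zpow_neg_one] at key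
  rw [ha, hb]
  exact key

/-- **`μ^{alg}` is an algebraic Hecke character** (type `A₀`) when `ψ` has an odd unitary ∞-type on a totally
complex field. [cite: Liu2021, §4.1, after Def. 4.3 (TeX l. 1926)] -/
theorem isAlgebraic_muAlg [IsTotallyComplex L] {ψ : IdeleClassGroup L →ₜ* Circle} {e : InfinitePlace L → ℤ}
    (he : HasInfinityType L ψ e) (hodd : ∀ w, Odd (e w)) : (muAlg L ψ).IsAlgebraic :=
  ((muAlg L ψ).isAlgebraic_iff_exists_hasInfinityType).2 ⟨_, _, hasInfinityType_muAlg he hodd⟩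

/-- **Weight one.**  If `ψ` has unitary ∞-type `e` with `e_w = ±1` everywhere (weight one, [Liu21] Def. 4.3 (1)),
then `μ^{alg}((x,1)) = ∏_{e_w = -1} ι_w(x_w)^{-1} · ∏_{e_w = 1} \overline{ι_w(x_w)}^{-1}`: the type is `z ↦ z^{-1}`
through the `[L:ℚ]/2` embeddings `{ι_w | e_w = −1} ∪ {\bar ι_w | e_w = 1}` (the CM type `Φ_μ` of `μ` in Liu's
normalisation `e = −𝔴`) — the shape `ρ ∘ τ' = μ^{alg}`, `τ' ∈ Φ_μ`, of [Liu21] Theorem 4.15.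
[cite: Liu2021, §4.1, Def. 4.3 and the display after it (TeX ll. 1915–1926)] -/
theorem hasInfinityType_muAlg_of_weight_one [IsTotallyComplex L] {ψ : IdeleClassGroup L →ₜ* Circle}
    {e : InfinitePlace L → ℤ} (he : HasInfinityType L ψ e) (h1 : ∀ w, e w = 1 ∨ e w = -1) :
    (muAlg L ψ).HasInfinityType (fun w => if e w = -1 then 1 else 0) (fun w => if e w = -1 then 0 else 1) := by
  have hodd : ∀ w, Odd (e w) := fun w => by
    rcases h1 w with h | h <;> rw [h] <;> decide
  have h := hasInfinityType_muAlg he hodd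
  have hp : (fun w => (1 - e w) / 2) = fun w => if e w = -1 then (1 : ℤ) else 0 := by
    funext w; rcases h1 w with h | h <;> rw [h] <;> decide
  have hq : (fun w => (1 + e w) / 2) = fun w => if e w = -1 then (0 : ℤ) else 1 := by
    funext w; rcases h1 w with h | h <;> rw [h] <;> decide
  rwa [hp, hq] at h

/-- **Weil's theorem for `μ^{alg}`: "`M_μ` … is a number field"**, in the form the tree's Weil-1956 theorem gives:
for `ψ` of odd unitary ∞-type on a totally complex `L` there is ONE subfield `E ⊆ ℂ`, finite over `ℚ` and
containing every conjugate of `L`, such that `μ^{alg}(ϖ_v) ∈ E` at every finite place `v` where `ψ` is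
unramified (`IsAlgebraic.exists_intermediateField_valueAtUniformizer_mem`).
[cite: Liu2021, §4.1, after Def. 4.3 (TeX ll. 1926–1927)] [cite: Weil1956, §1] -/
theorem exists_numberField_valueAtUniformizer_muAlg_mem [IsTotallyComplex L] {ψ : IdeleClassGroup L →ₜ* Circle}
    {e : InfinitePlace L → ℤ} (he : HasInfinityType L ψ e) (hodd : ∀ w, Odd (e w)) :
    ∃ E : IntermediateField ℚ ℂ, FiniteDimensional ℚ E ∧ (∀ (φ : L →+* ℂ) (x : L), φ x ∈ E) ∧
      ∀ v : HeightOneSpectrum (𝓞 L), (toHeckeCharacter L ψ).IsUnramifiedAt v →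
        (muAlg L ψ).valueAtUniformizer v ∈ E := by
  obtain ⟨E, hfd, hemb, hval⟩ := (isAlgebraic_muAlg he hodd).exists_intermediateField_valueAtUniformizer_mem
  exact ⟨E, hfd, hemb, fun v hv => hval v ((isUnramifiedAt_muAlg_iff L ψ v).2 hv)⟩

end InfinityType

/-! ## § 4. The CM case: conjugate symplectic `μ` ([Liu21] §4.1) -/

section CM

variable {L : Type} [Field L] [NumberField L] [IsCMField L]

/-- **[Liu21] §4.1 for a conjugate symplectic `μ`**: if `ψ` is conjugate symplectic with ∞-type `e` (necessarily
odd, `IsConjugateSymplectic.odd` = Remark 4.2), then `μ^{alg} = ψ·‖·‖^{-1/2}` has infinity type `((1−e)/2, (1+e)/2)`.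
[cite: Liu2021, §4.1, after Def. 4.3 (TeX ll. 1922–1926)] -/
theorem IsConjugateSymplectic.hasInfinityType_muAlg {ψ : IdeleClassGroup L →ₜ* Circle}
    (hψ : IsConjugateSymplectic L ψ) {e : InfinitePlace L → ℤ} (he : HasInfinityType L ψ e) :
    (muAlg L ψ).HasInfinityType (fun w => (1 - e w) / 2) (fun w => (1 + e w) / 2) :=
  IdeleClassGroup.hasInfinityType_muAlg he (hψ.odd he)

/-- **"`μ^{alg}`, which is then algebraic"** for every conjugate symplectic `μ` (its ∞-type exists,
`IsConjugateSymplectic.hasInfinityType_infinityType`, and is odd). [cite: Liu2021, §4.1, after Def. 4.3 (TeX l. 1926)] -/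
theorem IsConjugateSymplectic.isAlgebraic_muAlg {ψ : IdeleClassGroup L →ₜ* Circle}
    (hψ : IsConjugateSymplectic L ψ) : (muAlg L ψ).IsAlgebraic :=
  IdeleClassGroup.isAlgebraic_muAlg hψ.hasInfinityType_infinityType
    fun w => hψ.odd hψ.hasInfinityType_infinityType w

/-- **"`M_μ` … is a number field"** for conjugate symplectic `μ` (Weil form, see
`exists_numberField_valueAtUniformizer_muAlg_mem`). [cite: Liu2021, §4.1, after Def. 4.3 (TeX ll. 1926–1927)]
[cite: Weil1956, §1] -/
theorem IsConjugateSymplectic.exists_numberField_valueAtUniformizer_muAlg_mem {ψ : IdeleClassGroup L →ₜ* Circle}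
    (hψ : IsConjugateSymplectic L ψ) :
    ∃ E : IntermediateField ℚ ℂ, FiniteDimensional ℚ E ∧ (∀ (φ : L →+* ℂ) (x : L), φ x ∈ E) ∧
      ∀ v : HeightOneSpectrum (𝓞 L), (toHeckeCharacter L ψ).IsUnramifiedAt v →
        (muAlg L ψ).valueAtUniformizer v ∈ E :=
  IdeleClassGroup.exists_numberField_valueAtUniformizer_muAlg_mem hψ.hasInfinityType_infinityType
    fun w => hψ.odd hψ.hasInfinityType_infinityType w

end CM

/-! ## § 5. Liu's field of values `M_μ` and Remark 4.4 `M_{μ^c} = M_μ` -/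

section ValueField

variable (L : Type) [Field L] [NumberField L]

/-- **Liu's `M_μ ⊆ ℂ`**: "the subfield generated by values `μ^{alg}(x)` for `x ∈ (𝔸_E^∞)^×`" — the subfield of `ℂ`
generated by the values of `μ^{alg}` on the finite ideles (the ideles with archimedean component `1`).  Its
finiteness over `ℚ` (Liu: "which is a number field") is `finiteDimensional_muAlgValueField` (§ 6); Remark 4.4's
`M_{μ^c} = M_μ` is `muAlgValueField_galConj`.
[cite: Liu2021, §4.1, after Def. 4.3 (TeX ll. 1926–1927)] -/
def muAlgValueField (ψ : IdeleClassGroup L →ₜ* Circle) : Subfield ℂ :=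
  Subfield.closure (Set.range fun x : {x : ideleGroup L // (x : AdeleRing (𝓞 L) L).1 = 1} =>
    ((muAlg L ψ x.1 : ℂˣ) : ℂ))

/-- The value of `μ^{alg}` at a finite idele lies in `M_μ`. [cite: Liu2021, §4.1 (TeX l. 1927)] -/
theorem coe_muAlg_mem_muAlgValueField (ψ : IdeleClassGroup L →ₜ* Circle) {x : ideleGroup L}
    (hx : (x : AdeleRing (𝓞 L) L).1 = 1) : ((muAlg L ψ x : ℂˣ) : ℂ) ∈ muAlgValueField L ψ :=
  Subfield.subset_closure ⟨⟨x, hx⟩, rfl⟩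

/-- The idele `⟨u⟩_v = (…, 1, u, 1, …)` of a local element is a finite idele. [folklore] -/
private theorem localUnits_fst_eq_one (v : HeightOneSpectrum (𝓞 L)) (u : (v.adicCompletion L)ˣ) :
    ((localUnits v u : ideleGroup L) : AdeleRing (𝓞 L) L).1 = 1 :=
  localUnits_fst v u

/-- **`μ^{alg}(ϖ_v) ∈ M_μ`** for every finite place `v`. [cite: Liu2021, §4.1 (TeX l. 1927)] -/
theorem valueAtUniformizer_muAlg_mem_muAlgValueField (ψ : IdeleClassGroup L →ₜ* Circle)
    (v : HeightOneSpectrum (𝓞 L)) : (muAlg L ψ).valueAtUniformizer v ∈ muAlgValueField L ψ := by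
  rw [HeckeCharacter.valueAtUniformizer, HeckeCharacter.localComponent_apply]
  exact coe_muAlg_mem_muAlgValueField L ψ (localUnits_fst_eq_one L v _)

/-- Every local value `μ^{alg}(⟨u⟩_v)`, `u ∈ L_vˣ`, lies in `M_μ`. [cite: Liu2021, §4.1 (TeX l. 1927)] -/
theorem coe_localComponent_muAlg_mem_muAlgValueField (ψ : IdeleClassGroup L →ₜ* Circle)
    (v : HeightOneSpectrum (𝓞 L)) (u : (v.adicCompletion L)ˣ) :
    (((muAlg L ψ).localComponent v u : ℂˣ) : ℂ) ∈ muAlgValueField L ψ := by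
  rw [HeckeCharacter.localComponent_apply]
  exact coe_muAlg_mem_muAlgValueField L ψ (localUnits_fst_eq_one L v u)

variable {L}

/-- `σ ∈ Aut(L|K)` preserves the finite ideles: `(σ • x)_∞ = 1 ↔ x_∞ = 1`. [folklore] -/
private theorem smul_fst_eq_one_iff {K : Type} [Field K] [Algebra K L] (σ : L ≃ₐ[K] L) (x : ideleGroup L) :
    ((σ • x : ideleGroup L) : AdeleRing (𝓞 L) L).1 = 1 ↔ (x : AdeleRing (𝓞 L) L).1 = 1 := by
  rw [AdeleRing.coe_smul_units, AdeleRing.smul_fst]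
  constructor
  · intro h
    have := congrArg (fun y : InfiniteAdeleRing L => σ⁻¹ • y) h
    simpa only [inv_smul_smul, smul_one] using this
  · intro h
    rw [h, smul_one]

/-- **[Liu21] Remark 4.4, `M_{μ ∘ σ} = M_μ`**: the field of values of `(μ ∘ σ)^{alg} = μ^{alg} ∘ σ` on the finite
ideles is that of `μ^{alg}`, because `σ` permutes the finite ideles.  [cite: Liu2021, Remark 4.4 (TeX ll. 1930–1933)] -/
theorem muAlgValueField_galConj {K : Type} [Field K] [Algebra K L] (σ : L ≃ₐ[K] L)
    (ψ : IdeleClassGroup L →ₜ* Circle) : muAlgValueField L (galConj σ ψ) = muAlgValueField L ψ := by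
  unfold muAlgValueField
  congr 1
  ext z
  simp only [Set.mem_range, Subtype.exists, muAlg_galConj, HeckeCharacter.galConj_apply]
  constructor
  · rintro ⟨x, hx, rfl⟩
    exact ⟨σ • x, (smul_fst_eq_one_iff σ x).2 hx, rfl⟩
  · rintro ⟨x, hx, rfl⟩
    refine ⟨σ⁻¹ • x, (smul_fst_eq_one_iff σ⁻¹ x).2 hx, ?_⟩
    rw [smul_inv_smul]

/-- **[Liu21] Remark 4.4, `M_{μ^c} = M_μ`** for the complex conjugation `c` of a CM field.
[cite: Liu2021, Remark 4.4 (TeX ll. 1930–1933)] -/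
theorem muAlgValueField_galConj_complexConj [IsCMField L] (ψ : IdeleClassGroup L →ₜ* Circle) :
    muAlgValueField L (galConj (IsCMField.complexConj L) ψ) = muAlgValueField L ψ :=
  muAlgValueField_galConj _ ψ

end ValueField

/-! ## § 6. `M_μ` is a number field ([Liu21] §4.1, l. 1927) -/

section ValueFieldFinite

variable {L : Type} [Field L] [NumberField L]

/-- **[Liu21] §4.1, "`M_μ` … is a number field" — literally.**  For `ψ : C_L →ₜ* S¹` of odd unitary ∞-type on
a totally complex `L`, Liu's field `M_μ` (the subfield of `ℂ` generated by the values of `μ^{alg}` on the finite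
ideles, `muAlgValueField`) is contained in ONE subfield `E ⊆ ℂ` finite over `ℚ` and containing every conjugate
of `L` — Weil's field of `μ^{alg}` (`HeckeCharacter.IsAlgebraic.exists_numberField_coe_apply_mem_of_fst_eq_one`:
the values of an algebraic Hecke character on ALL finite ideles lie in Weil's number field).
[cite: Liu2021, §4.1, after Def. 4.3 (TeX ll. 1926–1927)] [cite: Weil1956, §1] -/
theorem exists_numberField_muAlgValueField_le [IsTotallyComplex L] {ψ : IdeleClassGroup L →ₜ* Circle}
    {e : InfinitePlace L → ℤ} (he : HasInfinityType L ψ e) (hodd : ∀ w, Odd (e w)) :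
    ∃ E : IntermediateField ℚ ℂ, FiniteDimensional ℚ E ∧ (∀ (φ : L →+* ℂ) (x : L), φ x ∈ E) ∧
      muAlgValueField L ψ ≤ E.toSubfield := by
  obtain ⟨E, hfd, hemb, hval⟩ :=
    (isAlgebraic_muAlg he hodd).exists_numberField_coe_apply_mem_of_fst_eq_one
  refine ⟨E, hfd, hemb, Subfield.closure_le.2 ?_⟩
  rintro _ ⟨⟨x, hx⟩, rfl⟩
  exact hval x hx

/-- **`M_μ` is a number field**: `[M_μ : ℚ] < ∞` for `ψ` of odd unitary ∞-type on a totally complex `L`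
(`M_μ ↪ E` for Weil's number field `E`). [cite: Liu2021, §4.1, after Def. 4.3 (TeX ll. 1926–1927)] -/
theorem finiteDimensional_muAlgValueField [IsTotallyComplex L] {ψ : IdeleClassGroup L →ₜ* Circle}
    {e : InfinitePlace L → ℤ} (he : HasInfinityType L ψ e) (hodd : ∀ w, Odd (e w)) :
    FiniteDimensional ℚ (muAlgValueField L ψ) := by
  obtain ⟨E, hfd, -, hle⟩ := exists_numberField_muAlgValueField_le he hodd
  let f : muAlgValueField L ψ →+* E :=
    { toFun := fun x => ⟨(x : ℂ), hle x.2⟩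
      map_one' := rfl
      map_mul' := fun _ _ => rfl
      map_zero' := rfl
      map_add' := fun _ _ => rfl }
  have hf : Function.Injective f := fun x y hxy => Subtype.ext (congrArg (fun z : E => (z : ℂ)) hxy)
  exact FiniteDimensional.of_injective f.toRatAlgHom.toLinearMap hf

variable [IsCMField L]

/-- **[Liu21] §4.1 for conjugate symplectic `μ`: "`M_μ` … is a number field containing …"** — the field
generated by the values of `μ^{alg}` on `(𝔸_E^∞)^×` is finite over `ℚ`.
[cite: Liu2021, §4.1, after Def. 4.3 (TeX ll. 1926–1927)] -/
theorem IsConjugateSymplectic.finiteDimensional_muAlgValueField {ψ : IdeleClassGroup L →ₜ* Circle}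
    (hψ : IsConjugateSymplectic L ψ) : FiniteDimensional ℚ (muAlgValueField L ψ) :=
  IdeleClassGroup.finiteDimensional_muAlgValueField hψ.hasInfinityType_infinityType
    fun w => hψ.odd hψ.hasInfinityType_infinityType w

/-- The values field of `μ^c` is finite over `ℚ` too (`M_{μ^c} = M_μ`, Remark 4.4).
[cite: Liu2021, Remark 4.4 (TeX ll. 1930–1933)] -/
theorem IsConjugateSymplectic.finiteDimensional_muAlgValueField_galConj {ψ : IdeleClassGroup L →ₜ* Circle}
    (hψ : IsConjugateSymplectic L ψ) :
    FiniteDimensional ℚ (muAlgValueField L (IdeleClassGroup.galConj (IsCMField.complexConj L) ψ)) := by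
  rw [muAlgValueField_galConj_complexConj]
  exact hψ.finiteDimensional_muAlgValueField

end ValueFieldFinite

/-! ## § 7. `M_μ ⊇ M'_μ` ([Liu21] §4.1, l. 1927: "containing `M'_μ`") — weight one -/

section ReflexInValueField

open Polynomial
open Literature.NumberTheory.ComplexMultiplication (cmTypeTrace traceField cmTypeTrace_apply)
open Literature.NumberTheory.ComplexMultiplication.CMTypeLattice (memberAt mk_memberAt memberAt_mk)
open Literature.AlgebraicGeometry.Motives (CMType)

variable {L : Type} [Field L] [NumberField L]

/-! ### § 7a. A Lagrange lemma: a complex polynomial taking values in a subfield `M ⊆ ℂ` at `0, 1, …, n ≥ deg`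
has its coefficients in `M` -/

/-- `Polynomial.map` of a Lagrange basis divisor along a field embedding. [folklore] -/
private theorem map_basisDivisor {F F' : Type*} [Field F] [Field F'] (f : F →+* F') (x y : F) :
    (Lagrange.basisDivisor x y).map f = Lagrange.basisDivisor (f x) (f y) := by
  simp only [Lagrange.basisDivisor, Polynomial.map_mul, Polynomial.map_C, map_inv₀, map_sub,
    Polynomial.map_sub, Polynomial.map_X]

/-- `Polynomial.map` of a Lagrange basis polynomial along a field embedding. [folklore] -/
private theorem map_lagrangeBasis {F F' : Type*} [Field F] [Field F'] (f : F →+* F') {ι : Type*}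
    [DecidableEq ι] (s : Finset ι) (v : ι → F) (i : ι) :
    (Lagrange.basis s v i).map f = Lagrange.basis s (f ∘ v) i := by
  unfold Lagrange.basis
  rw [Polynomial.map_prod]
  exact Finset.prod_congr rfl fun j _ => map_basisDivisor f _ _

/-- `Polynomial.map` of a Lagrange interpolant along a field embedding. [folklore] -/
private theorem map_interpolate {F F' : Type*} [Field F] [Field F'] (f : F →+* F') {ι : Type*}
    [DecidableEq ι] (s : Finset ι) (v r : ι → F) :
    (Lagrange.interpolate s v r).map f = Lagrange.interpolate s (f ∘ v) (f ∘ r) := by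
  rw [Lagrange.interpolate_apply, Lagrange.interpolate_apply, Polynomial.map_sum]
  exact Finset.sum_congr rfl fun i _ => by
    rw [Polynomial.map_mul, Polynomial.map_C, map_lagrangeBasis, Function.comp_apply]

/-- **Coefficients from values**: if a complex polynomial of degree `≤ n` takes values in a subfield `M ⊆ ℂ`
at the `n + 1` integers `0, 1, …, n`, then all its coefficients lie in `M` (Lagrange interpolation with rational
nodes: the interpolant is defined over `M`). [folklore] -/
private theorem coeff_mem_of_eval_natCast_mem {M : Subfield ℂ} {P : ℂ[X]} {n : ℕ} (hdeg : P.natDegree ≤ n)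
    (hval : ∀ i : ℕ, i ≤ n → P.eval (i : ℂ) ∈ M) (j : ℕ) : P.coeff j ∈ M := by
  classical
  set s : Finset ℕ := Finset.range (n + 1) with hs
  let rM : ℕ → M := fun i => if h : i ≤ n then ⟨P.eval (i : ℂ), hval i h⟩ else 0
  let Q : M[X] := Lagrange.interpolate s (fun i : ℕ => (i : M)) rM
  have hinj : Set.InjOn (fun i : ℕ => (i : ℂ)) s := Nat.cast_injective.injOn
  have hdegP : P.degree < s.card := by
    rw [hs, Finset.card_range]
    exact lt_of_le_of_lt Polynomial.degree_le_natDegree (by exact_mod_cast Nat.lt_succ_of_le hdeg)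
  have hP : P = Q.map M.subtype := by
    rw [map_interpolate]
    have h1 : (M.subtype : M → ℂ) ∘ (fun i : ℕ => (i : M)) = fun i : ℕ => (i : ℂ) := by
      funext i; simp
    rw [h1, Lagrange.eq_interpolate hinj hdegP]
    refine Lagrange.interpolate_eq_of_values_eq_on _ _ fun i hi => ?_
    have hi' : i ≤ n := Nat.lt_succ_iff.1 (Finset.mem_range.1 hi)
    simp [rM, hi']
  rw [hP, Polynomial.coeff_map]
  exact (Q.coeff j).2

/-- The coefficient of `X^{#s - 1}` in `∏_{i ∈ s} (X + a_i)` is `∑_i a_i` (Vieta). [folklore] -/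
private theorem coeff_prod_X_add_C_card_sub_one {ι : Type*} (s : Finset ι) (a : ι → ℂ) (hs : s.Nonempty) :
    (∏ i ∈ s, (X + C (a i))).coeff (s.card - 1) = ∑ i ∈ s, a i := by
  classical
  rw [Finset.prod_X_add_C_coeff s a (Nat.sub_le _ _),
    show s.card - (s.card - 1) = 1 from by have := hs.card_pos; omega,
    Finset.powersetCard_one, Finset.sum_map]
  exact Finset.sum_congr rfl fun i _ => by simp

/-- **From norms to traces**: if `∏_w (a_w + t) ∈ M` for every natural number `t`, then `∑_w a_w ∈ M`
(the polynomial `∏_w (X + a_w)` takes values in `M` on `ℕ`, so has coefficients in `M`; its second coefficient is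
`∑_w a_w`). [folklore] -/
private theorem sum_mem_of_forall_prod_add_natCast_mem {ι : Type*} [Fintype ι] (M : Subfield ℂ) (a : ι → ℂ)
    (h : ∀ t : ℕ, ∏ w, (a w + t) ∈ M) : ∑ w, a w ∈ M := by
  classical
  rcases isEmpty_or_nonempty ι with hι | hι
  · simp
  set P : ℂ[X] := ∏ w, (X + C (a w)) with hP
  have hdeg : P.natDegree ≤ Fintype.card ι := by
    rw [hP]
    refine (Polynomial.natDegree_prod_le _ _).trans ?_
    refine (Finset.sum_le_sum fun w _ => (Polynomial.natDegree_X_add_C (a w)).le).trans ?_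
    simp
  have hval : ∀ i : ℕ, i ≤ Fintype.card ι → P.eval (i : ℂ) ∈ M := fun i _ => by
    rw [hP, Polynomial.eval_prod]
    simp only [Polynomial.eval_add, Polynomial.eval_X, Polynomial.eval_C]
    simpa only [add_comm] using h i
  have hcoeff := coeff_mem_of_eval_natCast_mem hdeg hval (Fintype.card ι - 1)
  rwa [hP, ← Finset.card_univ, coeff_prod_X_add_C_card_sub_one _ _ Finset.univ_nonempty] at hcoeff

/-! ### § 7b. `μ^{alg}` on the finite part of a principal idele: the type norm `N_Φ(k) = ∏_{φ ∈ Φ} φ(k)` -/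

/-- The finite part `(k)^∞ = (k) · (k)_∞⁻¹` of a principal idele is a finite idele. [folklore] -/
private theorem principalIdele_mul_inv_infiniteIdeles_fst (k : Lˣ) :
    ((GaloisRepresentations.principalIdele L k * (infiniteIdeles L (globalToInfiniteUnits L k))⁻¹ : ideleGroup L) :
      AdeleRing (𝓞 L) L).1 = 1 := by
  rw [← map_inv, ideleGroup_val_fst_mul]
  change (GaloisRepresentations.principalIdele L k : AdeleRing (𝓞 L) L).1 *
      ((infiniteIdeles L (globalToInfiniteUnits L k)⁻¹ : ideleGroup L) : AdeleRing (𝓞 L) L).1 = 1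
  rw [principalIdele_fst, infiniteIdeles_fst, ← val_globalToInfiniteUnits, ← Units.val_mul, mul_inv_cancel,
    Units.val_one]

omit [NumberField L] in
open scoped Classical in
/-- The member of a CM type over `w`, as an `if`. [folklore] -/
private theorem coe_memberAt_eq_ite (Φ : CMType L) (w : InfinitePlace L) :
    ((memberAt Φ w).1 : L →+* ℂ) =
      if w.embedding ∈ Φ.1 then w.embedding else ComplexEmbedding.conjugate w.embedding := by
  unfold memberAt
  split_ifs <;> rfl

/-- **`μ^{alg}((k)^∞) = N_{Φ_μ}(k)`**: for `ψ` of unitary ∞-type `e` with `e_w = ±1` (weight one) and CM type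
`Φ = Φ_e` (`cmTypeOf`), the value of `μ^{alg}` at the finite part `(k)·(k)_∞⁻¹` of the principal idele of `k ∈ Lˣ`
is the type norm `∏_w φ_w(k)`, `φ_w ∈ Φ` the member over `w` (`μ^{alg}` kills `(k)`, and `μ^{alg}((k)_∞) = ∏_w φ_w(k)^{-1}`
by `hasInfinityType_muAlg_of_weight_one`). [cite: Liu2021, §4.1, Def. 4.3 (2) and the display after it (TeX ll. 1915–1927)] -/
theorem coe_muAlg_principal_finitePart_eq_typeNorm [IsCMField L] {ψ : IdeleClassGroup L →ₜ* Circle}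
    {e : InfinitePlace L → ℤ} (he : HasInfinityType L ψ e) (h1 : ∀ w, e w = 1 ∨ e w = -1)
    (hne : ∀ w, e w ≠ 0) (k : Lˣ) :
    ((muAlg L ψ (GaloisRepresentations.principalIdele L k * (infiniteIdeles L (globalToInfiniteUnits L k))⁻¹) : ℂˣ) : ℂ) =
      ∏ w : InfinitePlace L, (memberAt (cmTypeOf L e hne) w).1 (k : L) := by
  have hP : muAlg L ψ (GaloisRepresentations.principalIdele L k) = 1 :=
    (muAlg L ψ).map_principal (GaloisRepresentations.principalIdele_mem k)
  rw [map_mul, map_inv, hP, one_mul, Units.val_inv_eq_inv_val,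
    (hasInfinityType_muAlg_of_weight_one he h1).apply_globalToInfiniteUnits_eq_of_isTotallyComplex k,
    ← Finset.prod_inv_distrib]
  refine Finset.prod_congr rfl fun w _ => ?_
  rw [coe_memberAt_eq_ite, embedding_mem_cmTypeOf_iff]
  rcases h1 w with h | h
  · have hlt : ¬ e w < 0 := by rw [h]; decide
    have hne1 : e w ≠ -1 := by rw [h]; decide
    rw [if_neg hlt, if_neg hne1, if_neg hne1, ComplexEmbedding.conjugate_coe_eq]
    simp
  · have hlt : e w < 0 := by rw [h]; decide
    rw [if_pos hlt, if_pos h, if_pos h]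
    simp

/-- **The type norms lie in `M_μ`**: `N_Φ(x) = ∏_w φ_w(x) ∈ M_μ` for every `x ∈ L` (weight one).
[cite: Liu2021, §4.1, after Def. 4.3 (TeX ll. 1926–1927)] -/
theorem typeNorm_mem_muAlgValueField [IsCMField L] {ψ : IdeleClassGroup L →ₜ* Circle}
    {e : InfinitePlace L → ℤ} (he : HasInfinityType L ψ e) (h1 : ∀ w, e w = 1 ∨ e w = -1)
    (hne : ∀ w, e w ≠ 0) (x : L) :
    (∏ w : InfinitePlace L, (memberAt (cmTypeOf L e hne) w).1 x) ∈ muAlgValueField L ψ := by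
  by_cases hx : x = 0
  · obtain ⟨w⟩ : Nonempty (InfinitePlace L) := inferInstance
    rw [Finset.prod_eq_zero (Finset.mem_univ w) (by rw [hx, map_zero])]
    exact (muAlgValueField L ψ).zero_mem
  · rw [show x = ((Units.mk0 x hx : Lˣ) : L) from rfl, ← coe_muAlg_principal_finitePart_eq_typeNorm he h1 hne]
    exact coe_muAlg_mem_muAlgValueField L ψ (principalIdele_mul_inv_infiniteIdeles_fst _)

/-! ### § 7c. `M_μ ⊇ M'_μ`: the type traces, hence the reflex field `ℚ(tr_Φ(x))`, lie in `M_μ` -/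

omit [NumberField L] in
/-- The complex type trace as a sum over the infinite places (a CM type is a system of representatives of the
places, `CMTypeLattice.placeEquiv`). [folklore] -/
private theorem cmTypeTrace_eq_sum_memberAt [NumberField L] (Φ : CMType L) (x : L) :
    cmTypeTrace Φ x = ∑ w : InfinitePlace L, (memberAt Φ w).1 x := by
  classical
  rw [cmTypeTrace_apply]
  refine Finset.sum_nbij' (fun φ => InfinitePlace.mk φ) (fun w => (memberAt Φ w).1) (fun _ _ => Finset.mem_univ _)
    (fun w _ => (Set.Finite.mem_toFinset _).2 (memberAt Φ w).2) (fun φ hφ => ?_) (fun w _ => mk_memberAt Φ w)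
    (fun φ hφ => ?_)
  · have hφ' : φ ∈ Φ.1 := (Set.Finite.mem_toFinset _).1 hφ
    exact congrArg Subtype.val (memberAt_mk Φ ⟨φ, hφ'⟩)
  · have hφ' : φ ∈ Φ.1 := (Set.Finite.mem_toFinset _).1 hφ
    rw [show memberAt Φ (InfinitePlace.mk φ) = ⟨φ, hφ'⟩ from memberAt_mk Φ ⟨φ, hφ'⟩]

/-- **The type traces lie in `M_μ`** (weight one): `tr_Φ(x) = ∑_w φ_w(x) ∈ M_μ`, because
`N_Φ(x + t) = ∏_w (φ_w(x) + t) ∈ M_μ` for every `t ∈ ℕ` (`typeNorm_mem_muAlgValueField`) and the polynomial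
`∏_w (X + φ_w(x))`, taking values in `M_μ` on `ℕ`, has its coefficients in `M_μ`.
[cite: Liu2021, §4.1, after Def. 4.3 (TeX l. 1927, "containing `M'_μ`")] -/
theorem cmTypeTrace_mem_muAlgValueField [IsCMField L] {ψ : IdeleClassGroup L →ₜ* Circle}
    {e : InfinitePlace L → ℤ} (he : HasInfinityType L ψ e) (h1 : ∀ w, e w = 1 ∨ e w = -1)
    (hne : ∀ w, e w ≠ 0) (x : L) :
    cmTypeTrace (cmTypeOf L e hne) x ∈ muAlgValueField L ψ := by
  rw [cmTypeTrace_eq_sum_memberAt]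
  refine sum_mem_of_forall_prod_add_natCast_mem (muAlgValueField L ψ) _ fun t => ?_
  have h := typeNorm_mem_muAlgValueField he h1 hne (x + t)
  simp only [map_add, map_natCast] at h
  exact h

/-- **[Liu21] §4.1: "`M_μ` … is a number field containing `M'_μ`" — the containment**, weight one.  For `ψ` of
unitary ∞-type `e` with `e_w = ±1` and CM type `Φ = Φ_e`, Liu's `M'_μ ⊆ ℂ` — the reflex field of `(E, Φ_μ)` inside
`ℂ`, which is the tree's `traceField Φ = ℚ(tr_Φ(x) | x ∈ E)` (`ComplexMultiplication/ComplexReflexField`, Shimura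
§8.3 Prop. 28: `K* = ℚ(∑ᵢ ξ^{φᵢ})`) — is contained in `M_μ` (`muAlgValueField`).  (General odd weight:
`traceField_le_muAlgValueField_of_odd`, § 8, by the Galois description of the reflex field; this weight-one proof is
the elementary Lagrange argument.) [cite: Liu2021, §4.1, after Def. 4.3 (TeX l. 1927)] [cite: Shimura1998, §8.3 Prop. 28] -/
theorem traceField_le_muAlgValueField [IsCMField L] {ψ : IdeleClassGroup L →ₜ* Circle}
    {e : InfinitePlace L → ℤ} (he : HasInfinityType L ψ e) (h1 : ∀ w, e w = 1 ∨ e w = -1)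
    (hne : ∀ w, e w ≠ 0) :
    (traceField (cmTypeOf L e hne)).toSubfield ≤ muAlgValueField L ψ := by
  set M := muAlgValueField L ψ with hM
  let M' : IntermediateField ℚ ℂ := M.toIntermediateField fun q => by
    rw [eq_ratCast]
    exact SubfieldClass.ratCast_mem M q
  have hle : traceField (cmTypeOf L e hne) ≤ M' := by
    rw [traceField, IntermediateField.adjoin_le_iff]
    rintro _ ⟨x, rfl⟩
    exact cmTypeTrace_mem_muAlgValueField he h1 hne x
  intro z hz
  exact hle hz

variable [IsCMField L]

/-- **[Liu21] §4.1 / Def. 4.3, for a conjugate symplectic `μ` of weight one with CM type `Φ_μ`: `M'_μ ⊆ M_μ`**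
(`M'_μ = traceField Φ_μ`, `M_μ = muAlgValueField`). [cite: Liu2021, §4.1, after Def. 4.3 (TeX l. 1927)] -/
theorem HasCMType.traceField_le_muAlgValueField {ψ : IdeleClassGroup L →ₜ* Circle} {Φ : CMType L}
    (hΦ : HasCMType L ψ Φ) (hw : HasWeight L ψ 1) : (traceField Φ).toSubfield ≤ muAlgValueField L ψ := by
  obtain ⟨e, hne, he, rfl⟩ := hΦ
  obtain ⟨e', he', hwt⟩ := hw
  obtain rfl := hasInfinityType_unique he he'
  have h1 : ∀ w, e w = 1 ∨ e w = -1 := fun w => by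
    have hw1 : (e w).natAbs = 1 := by
      have := congrFun hwt w
      simpa only [weight_apply, Pi.one_apply] using this
    rcases Int.natAbs_eq (e w) with h | h <;> rw [hw1] at h <;> [left; right] <;> exact_mod_cast h
  exact IdeleClassGroup.traceField_le_muAlgValueField he h1 hne

/-- The same with `M_μ` finite over `ℚ` (`IsConjugateSymplectic.finiteDimensional_muAlgValueField`): for a conjugate
symplectic `μ` of weight one, **`M'_μ ⊆ M_μ ⊆ E`, `E` a number field** — Liu's "`M_μ` … is a number field containing
`M'_μ`" in full for weight one. [cite: Liu2021, §4.1, after Def. 4.3 (TeX ll. 1926–1927)] -/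
theorem IsConjugateSymplectic.traceField_le_and_finiteDimensional {ψ : IdeleClassGroup L →ₜ* Circle}
    (hψ : IsConjugateSymplectic L ψ) {Φ : CMType L} (hΦ : HasCMType L ψ Φ) (hw : HasWeight L ψ 1) :
    (traceField Φ).toSubfield ≤ muAlgValueField L ψ ∧ FiniteDimensional ℚ (muAlgValueField L ψ) :=
  ⟨hΦ.traceField_le_muAlgValueField hw, hψ.finiteDimensional_muAlgValueField⟩

end ReflexInValueField

/-! ## § 8. `M_μ ⊇ M'_μ` for every conjugate symplectic `μ` (any odd weight) -/

section ReflexGalois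

open scoped Pointwise
open Polynomial
open Literature.NumberTheory.ComplexMultiplication
open Literature.NumberTheory.NumberFields (isGalois_normalClosure_complex)
open Literature.AlgebraicGeometry.Motives (CMType)

variable {K : Type} [Field K] [NumberField K]

/-! ### § 8a. Root multiplicities of `∏ᵢ (X - aᵢ)^{mᵢ}` -/

/-- The multiplicity of `b` as a root of `∏ᵢ (X - aᵢ)^{mᵢ}` is `∑_{i : aᵢ = b} mᵢ`. [folklore] -/
private theorem count_roots_prod_X_sub_C_pow {R : Type*} [CommRing R] [IsDomain R] [DecidableEq R]
    {ι : Type*} [Fintype ι] (a : ι → R) (m : ι → ℕ) (b : R) :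
    (∏ i, (X - C (a i)) ^ m i).roots.count b = ∑ i, if b = a i then m i else 0 := by
  classical
  have hne : ∏ i, (X - C (a i)) ^ m i ≠ 0 :=
    Finset.prod_ne_zero_iff.2 fun i _ => pow_ne_zero _ (X_sub_C_ne_zero (a i))
  rw [roots_prod _ _ hne, Multiset.count_bind, Finset.sum_eq_multiset_sum]
  refine congrArg Multiset.sum (Multiset.map_congr rfl fun i _ => ?_)
  rw [roots_pow, roots_X_sub_C, Multiset.count_nsmul, Multiset.count_singleton]
  split_ifs <;> simp

/-! ### § 8b. A subfield of `ℂ` containing the generalised type norms contains the reflex field -/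

/-- **Galois-theoretic core of "`M_μ ⊇ M'_μ`".**  Let `Φ` be a CM type of the number field `K`, `M ⊆ ℂ` a
subfield, and `n : Hom(K, ℂ) → ℤ_{≥ 0}` exponents of which `Φ` is a superlevel set (`φ ∈ Φ ↔ t < n_φ`).  If the
generalised type norms `∏_φ φ(y)^{n_φ}`, `y ∈ K`, all lie in `M`, then `M` contains the reflex field
`ℚ(tr_Φ(K))` of `(K, Φ)` (`traceField`).  Proof: in the Galois closure `Ω ⊆ ℂ` of `K`, an automorphism `σ` fixing
`M ∩ Ω` fixes the polynomial `∏_φ (X - φ(k))^{n_φ} ∈ (M ∩ Ω)[X]` (`k` a primitive element; its coefficients lie in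
`M` by Lagrange interpolation at `X = 0, 1, 2, …`), hence preserves the multiplicities `n_φ` of its (distinct) roots
`φ(k)`, hence stabilises `Φ`; so `Gal(Ω/M ∩ Ω) ≤ Stab(Φ)` and `K* = Ω^{Stab(Φ)} ⊆ M ∩ Ω`.
[cite: Shimura1998, §8.3 Prop. 28] -/
theorem traceField_le_of_forall_prod_zpow_mem (Φ : CMType K) (M : Subfield ℂ) (n : (K →+* ℂ) → ℤ) (t : ℤ)
    (hn0 : ∀ φ, 0 ≤ n φ) (hn : ∀ φ, φ ∈ Φ.1 ↔ t < n φ)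
    (h : ∀ y : K, ∏ φ : K →+* ℂ, φ y ^ n φ ∈ M) :
    (traceField Φ).toSubfield ≤ M := by
  classical
  -- natural exponents
  set N : (K →+* ℂ) → ℕ := fun φ => (n φ).toNat with hN
  have hNn : ∀ φ, ((N φ : ℕ) : ℤ) = n φ := fun φ => Int.toNat_of_nonneg (hn0 φ)
  have hN' : ∀ y : K, ∏ φ : K →+* ℂ, φ y ^ N φ ∈ M := fun y => by
    have hy := h y
    simp_rw [← hNn, zpow_natCast] at hy
    exact hy
  -- the Galois closure `Ω ⊆ ℂ` of `K`
  let Ω : IntermediateField ℚ ℂ := IntermediateField.normalClosure ℚ K ℂ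
  haveI : IsGalois ℚ Ω := isGalois_normalClosure_complex K
  obtain ⟨φ₀⟩ : Nonempty (K →+* ℂ) := inferInstance
  let ι : Ω →+* ℂ := algebraMap Ω ℂ
  let j : K →ₐ[ℚ] Ω :=
    { toFun := fun x => ⟨φ₀ x, AlgHom.fieldRange_le_normalClosure φ₀.toRatAlgHom ⟨x, rfl⟩⟩
      map_one' := Subtype.ext (map_one φ₀)
      map_mul' := fun x y => Subtype.ext (map_mul φ₀ x y)
      map_zero' := Subtype.ext (map_zero φ₀)
      map_add' := fun x y => Subtype.ext (map_add φ₀ x y)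
      commutes' := fun q => Subtype.ext (by simp) }
  -- `M ∩ Ω` as an intermediate field of `Ω`
  let M' : IntermediateField ℚ Ω := (M.comap ι).toIntermediateField fun q => by
    rw [Subfield.mem_comap, eq_ratCast, map_ratCast]
    exact SubfieldClass.ratCast_mem M q
  have hM' : ∀ z : Ω, z ∈ M' ↔ (z : ℂ) ∈ M := fun z => Iff.rfl
  -- a primitive element `k` of `K/ℚ`: embeddings are determined by their value at `k`
  let pb := Field.powerBasisOfFiniteOfSeparable ℚ K
  have hinj : ∀ χ χ' : K →ₐ[ℚ] Ω, χ pb.gen = χ' pb.gen → χ = χ' := fun χ χ' hk => pb.algHom_ext hk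
  -- the polynomial `Q = ∏_χ (X - χ(k))^{n_{ι ∘ χ}} ∈ Ω[X]`
  set Q : Polynomial Ω := ∏ χ : K →ₐ[ℚ] Ω, (X - C (χ pb.gen)) ^ N (ι.comp (χ : K →+* Ω)) with hQ
  have hQmap : Q.map ι = ∏ φ : K →+* ℂ, (X - C (φ pb.gen)) ^ N φ := by
    rw [hQ, Polynomial.map_prod]
    simp only [Polynomial.map_pow, Polynomial.map_sub, map_X, map_C]
    exact Fintype.prod_equiv (algHomEquivRingHomOfNormal j ι) _ _ fun χ => rfl
  -- its coefficients lie in `M` (Lagrange: its values at `X = 0, 1, 2, …` are generalised type norms)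
  have hPcoeff : ∀ i, ι (Q.coeff i) ∈ M := fun i => by
    rw [← coeff_map, hQmap]
    refine coeff_mem_of_eval_natCast_mem (n := ∑ φ : K →+* ℂ, N φ) ?_ (fun m _ => ?_) i
    · refine (natDegree_prod_le _ _).trans (Finset.sum_le_sum fun φ _ => ?_)
      refine natDegree_pow_le.trans ?_
      rw [natDegree_X_sub_C, mul_one]
    · rw [eval_prod]
      simp only [eval_pow, eval_sub, eval_X, eval_C]
      have hm := hN' ((m : K) - pb.gen)
      simp only [map_sub, map_natCast] at hm
      exact hm
  -- KEY: `Gal(Ω / M ∩ Ω) ≤ Stab(Φ_Ω)`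
  set S : Set (K →ₐ[ℚ] Ω) := algValuedIn ι Φ.1 with hS
  have hkey : M'.fixingSubgroup ≤ MulAction.stabilizer (Ω ≃ₐ[ℚ] Ω) S := by
    intro σ hσ
    rw [IntermediateField.mem_fixingSubgroup_iff] at hσ
    -- `σ` fixes `Q`
    have hσQ : Q.map (σ : Ω →+* Ω) = Q := Polynomial.ext fun i => by
      rw [coeff_map]
      exact hσ _ ((hM' _).2 (hPcoeff i))
    -- compare the multiplicity of the root `σ(χ₀ k)` on both sides
    have hcount : ∀ χ₀ : K →ₐ[ℚ] Ω, N (ι.comp ↑(σ • χ₀)) = N (ι.comp ↑χ₀) := fun χ₀ => by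
      have h1 : (Q.map (σ : Ω →+* Ω)).roots.count (σ (χ₀ pb.gen)) = N (ι.comp ↑χ₀) := by
        rw [hQ, Polynomial.map_prod]
        simp only [Polynomial.map_pow, Polynomial.map_sub, map_X, map_C, RingHom.coe_coe]
        rw [count_roots_prod_X_sub_C_pow]
        have hiff : ∀ χ : K →ₐ[ℚ] Ω, σ (χ₀ pb.gen) = σ (χ pb.gen) ↔ χ₀ = χ := fun χ =>
          σ.injective.eq_iff.trans ⟨hinj _ _, fun h => h ▸ rfl⟩
        simp_rw [hiff, Finset.sum_ite_eq, Finset.mem_univ, if_true]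
      have h2 : Q.roots.count (σ (χ₀ pb.gen)) = N (ι.comp ↑(σ • χ₀)) := by
        rw [hQ, count_roots_prod_X_sub_C_pow]
        have hiff : ∀ χ : K →ₐ[ℚ] Ω, σ (χ₀ pb.gen) = χ pb.gen ↔ σ • χ₀ = χ := fun χ =>
          ⟨fun h => hinj _ _ (by rwa [algEquiv_smul_apply]), fun h => by rw [← h, algEquiv_smul_apply]⟩
        simp_rw [hiff, Finset.sum_ite_eq, Finset.mem_univ, if_true]
      rw [← h2, ← h1, hσQ]
    rw [MulAction.mem_stabilizer_set_iff_smul_set_subset (Set.toFinite S)]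
    rintro _ ⟨χ, hχ, rfl⟩
    rw [hS, mem_algValuedIn_iff, hn, ← hNn] at hχ ⊢
    rwa [hcount χ]
  -- hence `K* = Ω^{Stab(Φ_Ω)} ≤ Ω^{Gal(Ω / M ∩ Ω)} = M ∩ Ω`
  have hle : reflexField ℚ Ω S ≤ M' :=
    (IntermediateField.fixedField_le hkey).trans (IsGalois.fixedField_fixingSubgroup M').le
  intro z hz
  rw [← map_reflexField_algValuedIn j ι Φ] at hz
  have hz' : z ∈ (reflexField ℚ Ω S).map ι.toRatAlgHom := hz
  obtain ⟨r, hr, rfl⟩ := (IntermediateField.mem_map _).1 hz'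
  exact (hM' r).1 (hle hr)

end ReflexGalois

section GeneralWeight

open Literature.NumberTheory.ComplexMultiplication (traceField)
open Literature.NumberTheory.ComplexMultiplication.CMTypeLattice (memberAt)
open Literature.AlgebraicGeometry.Motives (CMType)
open GaloisRepresentations NumberField.InfinitePlace

variable {L : Type} [Field L] [NumberField L]

/-! ### § 8c. `μ^{alg}((k)^∞)` for arbitrary odd weight: the generalised type norm -/

/-- Over a totally complex field the complex embeddings come in the pairs `{φ_w, \bar φ_w}` over the infinite
places `w`. [folklore] -/
private theorem prod_embeddings_eq_prod_infinitePlace [IsTotallyComplex L] {β : Type*} [CommMonoid β]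
    (f : (L →+* ℂ) → β) :
    ∏ φ : L →+* ℂ, f φ =
      ∏ w : InfinitePlace L, (f w.embedding * f (ComplexEmbedding.conjugate w.embedding)) := by
  classical
  rw [← Finset.prod_fiberwise_of_maps_to (g := fun φ : L →+* ℂ => InfinitePlace.mk φ)
    (fun φ _ => Finset.mem_univ (InfinitePlace.mk φ)) f]
  refine Finset.prod_congr rfl fun w _ => ?_
  have hne : w.embedding ≠ ComplexEmbedding.conjugate w.embedding := fun h =>
    (isComplex_iff.1 (IsTotallyComplex.isComplex w)) (ComplexEmbedding.isReal_iff.2 h.symm)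
  have hfib : (Finset.univ.filter fun φ : L →+* ℂ => InfinitePlace.mk φ = w) =
      {w.embedding, ComplexEmbedding.conjugate w.embedding} := by
    ext φ
    simp only [Finset.mem_filter, Finset.mem_univ, true_and, Finset.mem_insert, Finset.mem_singleton]
    constructor
    · intro h
      rcases embedding_mk_eq φ with h1 | h1
      · left
        rw [← h]
        exact h1.symm
      · right
        rw [← h, h1]
        exact RingHom.ext fun x => by
          rw [ComplexEmbedding.conjugate_coe_eq, ComplexEmbedding.conjugate_coe_eq, Complex.conj_conj]
    · rintro (rfl | rfl)
      · exact mk_embedding w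
      · rw [mk_conjugate_eq, mk_embedding]
  rw [hfib, Finset.prod_pair hne]

omit [NumberField L] in
/-- The exponent in the coordinate `φ` is `± e_{mk φ}`. [folklore] -/
private theorem exponentAt_eq_or (e : InfinitePlace L → ℤ) (φ : L →+* ℂ) :
    exponentAt e φ = e (InfinitePlace.mk φ) ∨ exponentAt e φ = -e (InfinitePlace.mk φ) := by
  unfold exponentAt
  split_ifs <;> simp

/-- **`μ^{alg}((k)^∞) = ∏_φ φ(k)^{(1 - ε_φ)/2}`** for every odd unitary ∞-type `e` (any weight): the value of
`μ^{alg}` at the finite part `(k)·(k)_∞⁻¹` of the principal idele of `k ∈ Lˣ` is the generalised type norm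
`∏_{φ : L → ℂ} φ(k)^{(1 - ε_φ)/2}`, where `ε_φ = exponentAt e φ = ∓𝔴_w` is the exponent of `e` in the coordinate
`φ` (so the exponent of `φ ∈ Φ_μ` is `(1 + 𝔴)/2 ≥ 1` and that of `\bar φ` is `(1 - 𝔴)/2 ≤ 0`; weight one:
`N_Φ(k)`, `coe_muAlg_principal_finitePart_eq_typeNorm`). [cite: Liu2021, §4.1, Remark 4.2 and the display
after Def. 4.3 (TeX ll. 1904–1927)] -/
theorem coe_muAlg_principal_finitePart_eq_prod_zpow [IsTotallyComplex L] {ψ : IdeleClassGroup L →ₜ* Circle}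
    {e : InfinitePlace L → ℤ} (he : HasInfinityType L ψ e) (hodd : ∀ w, Odd (e w)) (k : Lˣ) :
    ((muAlg L ψ (GaloisRepresentations.principalIdele L k * (infiniteIdeles L (globalToInfiniteUnits L k))⁻¹) :
      ℂˣ) : ℂ) = ∏ φ : L →+* ℂ, φ (k : L) ^ ((1 - exponentAt e φ) / 2) := by
  have hP : muAlg L ψ (GaloisRepresentations.principalIdele L k) = 1 :=
    (muAlg L ψ).map_principal (GaloisRepresentations.principalIdele_mem k)
  rw [map_mul, map_inv, hP, one_mul, Units.val_inv_eq_inv_val,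
    (hasInfinityType_muAlg he hodd).apply_globalToInfiniteUnits_eq_of_isTotallyComplex k,
    prod_embeddings_eq_prod_infinitePlace (fun φ : L →+* ℂ => φ (k : L) ^ ((1 - exponentAt e φ) / 2)),
    ← Finset.prod_inv_distrib]
  refine Finset.prod_congr rfl fun w _ => ?_
  rw [mul_inv, ← zpow_neg, ← zpow_neg, neg_neg, neg_neg, exponentAt_embedding,
    exponentAt_conjugate_embedding e (IsTotallyComplex.isComplex w), sub_neg_eq_add,
    ComplexEmbedding.conjugate_coe_eq]

variable [IsCMField L]

/-- **The generalised type norms lie in `M_μ`.**  For `ψ` of odd unitary ∞-type `e`, `s ∈ ℕ` and `y ∈ Lˣ`,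
`∏_φ φ(y)^{s + (1 - ε_φ)/2} = μ^{alg}((y)^∞)^{s+1} · μ^{alg}((\bar y)^∞)^{s} ∈ M_μ` (`\bar y = c(y)` the
complex conjugate in the CM field `L`, `φ(c y) = \overline{φ(y)}`; both factors are values of `μ^{alg}` at
finite ideles). [cite: Liu2021, §4.1, after Def. 4.3 (TeX ll. 1926–1927)] -/
theorem prod_embeddings_zpow_mem_muAlgValueField {ψ : IdeleClassGroup L →ₜ* Circle}
    {e : InfinitePlace L → ℤ} (he : HasInfinityType L ψ e) (hodd : ∀ w, Odd (e w)) (s : ℕ) (y : Lˣ) :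
    ∏ φ : L →+* ℂ, φ (y : L) ^ ((s : ℤ) + (1 - exponentAt e φ) / 2) ∈ muAlgValueField L ψ := by
  classical
  have hcy : NumberField.IsCMField.complexConj L (y : L) ≠ 0 :=
    (map_ne_zero (NumberField.IsCMField.complexConj L)).2 y.ne_zero
  set y' : Lˣ := Units.mk0 _ hcy with hy'
  -- the two values of `μ^{alg}` at finite ideles
  have hV : ((muAlg L ψ (GaloisRepresentations.principalIdele L y *
      (infiniteIdeles L (globalToInfiniteUnits L y))⁻¹) : ℂˣ) : ℂ) ∈ muAlgValueField L ψ :=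
    coe_muAlg_mem_muAlgValueField L ψ (principalIdele_mul_inv_infiniteIdeles_fst y)
  have hV' : ((muAlg L ψ (GaloisRepresentations.principalIdele L y' *
      (infiniteIdeles L (globalToInfiniteUnits L y'))⁻¹) : ℂˣ) : ℂ) ∈ muAlgValueField L ψ :=
    coe_muAlg_mem_muAlgValueField L ψ (principalIdele_mul_inv_infiniteIdeles_fst y')
  rw [coe_muAlg_principal_finitePart_eq_prod_zpow he hodd] at hV hV'
  -- `∏ φ(c y)^{(1-ε_φ)/2} = ∏ φ(y)^{(1+ε_φ)/2}` (reindex by `φ ↦ \bar φ`)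
  have hinv : Function.Involutive (ComplexEmbedding.conjugate : (L →+* ℂ) → (L →+* ℂ)) := fun φ =>
    RingHom.ext fun x => by
      rw [ComplexEmbedding.conjugate_coe_eq, ComplexEmbedding.conjugate_coe_eq, Complex.conj_conj]
  have hV'' : ∏ φ : L →+* ℂ, φ (y : L) ^ ((1 + exponentAt e φ) / 2) ∈ muAlgValueField L ψ := by
    have heq : ∏ φ : L →+* ℂ, φ (y' : L) ^ ((1 - exponentAt e φ) / 2) =
        ∏ φ : L →+* ℂ, φ (y : L) ^ ((1 + exponentAt e φ) / 2) := by
      refine Fintype.prod_equiv (hinv.toPerm _) _ _ fun φ => ?_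
      rw [Function.Involutive.coe_toPerm, ComplexEmbedding.conjugate_coe_eq,
        exponentAt_conjugate e (IsTotallyComplex.complexEmbedding_not_isReal φ), hy', Units.val_mk0,
        NumberField.IsCMField.complexEmbedding_complexConj, ← sub_eq_add_neg]
    rw [← heq]
    exact hV'
  -- combine the exponents: `(s+1)(1-ε)/2 + s(1+ε)/2 = s + (1-ε)/2` (`ε` odd)
  have key : ∏ φ : L →+* ℂ, φ (y : L) ^ ((s : ℤ) + (1 - exponentAt e φ) / 2) =
      (∏ φ : L →+* ℂ, φ (y : L) ^ ((1 - exponentAt e φ) / 2)) ^ (s + 1) *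
        (∏ φ : L →+* ℂ, φ (y : L) ^ ((1 + exponentAt e φ) / 2)) ^ s := by
    rw [← Finset.prod_pow, ← Finset.prod_pow, ← Finset.prod_mul_distrib]
    refine Finset.prod_congr rfl fun φ _ => ?_
    have hφ0 : φ (y : L) ≠ 0 := (map_ne_zero φ).2 y.ne_zero
    rw [← zpow_natCast, ← zpow_natCast, ← zpow_mul, ← zpow_mul, ← zpow_add₀ hφ0]
    congr 1
    obtain ⟨r, hr⟩ : Odd (exponentAt e φ) := by
      rcases exponentAt_eq_or e φ with h | h <;> rw [h]
      · exact hodd _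
      · exact (hodd _).neg
    have ha : (1 - exponentAt e φ) / 2 = -r := by omega
    have hb : (1 + exponentAt e φ) / 2 = r + 1 := by omega
    rw [ha, hb]
    push_cast
    ring
  rw [key]
  exact mul_mem (pow_mem hV _) (pow_mem hV'' _)

/-! ### § 8d. `M_μ ⊇ M'_μ` for conjugate symplectic `μ` of ANY (odd) weight -/

/-- **[Liu21] §4.1: "`M_μ` … is a number field containing `M'_μ`" — the containment, general (odd) weight.**
For `ψ : C_L →ₜ* S¹` of odd unitary ∞-type `e` (zero-free, CM type `Φ_μ = cmTypeOf e`), Liu's reflex field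
`M'_μ ⊆ ℂ` of `(E, Φ_μ)` — the tree's `traceField Φ_μ = ℚ(tr_Φ(x))` (Shimura §8.3 Prop. 28) — is contained in
`M_μ = muAlgValueField` (the field generated by the values of `μ^{alg}` on the finite ideles).  Proof: the
generalised type norms `∏_φ φ(y)^{s + (1-ε_φ)/2}` lie in `M_μ` (`prod_embeddings_zpow_mem_muAlgValueField`), their
exponents are `> s` exactly on `Φ_μ`, and a subfield of `ℂ` containing them contains the reflex field
(`traceField_le_of_forall_prod_zpow_mem`).  The weight-one case is `traceField_le_muAlgValueField`.
[cite: Liu2021, §4.1, after Def. 4.3 (TeX l. 1927)] [cite: Shimura1998, §8.3 Prop. 28] -/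
theorem traceField_le_muAlgValueField_of_odd {ψ : IdeleClassGroup L →ₜ* Circle}
    {e : InfinitePlace L → ℤ} (he : HasInfinityType L ψ e) (hodd : ∀ w, Odd (e w)) (hne : ∀ w, e w ≠ 0) :
    (traceField (cmTypeOf L e hne)).toSubfield ≤ muAlgValueField L ψ := by
  classical
  set s : ℕ := ∑ w, (e w).natAbs with hs
  have hexp : ∀ φ : L →+* ℂ, (∃ r : ℤ, exponentAt e φ = 2 * r + 1) ∧
      exponentAt e φ ≤ s ∧ -exponentAt e φ ≤ s := fun φ => by
    have hle : ((e (InfinitePlace.mk φ)).natAbs : ℤ) ≤ s := by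
      rw [hs]
      exact_mod_cast Finset.single_le_sum (f := fun w => (e w).natAbs) (fun _ _ => Nat.zero_le _)
        (Finset.mem_univ (InfinitePlace.mk φ))
    have h1 := Int.le_natAbs (a := e (InfinitePlace.mk φ))
    have h2 : -e (InfinitePlace.mk φ) ≤ ((e (InfinitePlace.mk φ)).natAbs : ℤ) := by
      have := Int.le_natAbs (a := -e (InfinitePlace.mk φ))
      rwa [Int.natAbs_neg] at this
    obtain ⟨r, hr⟩ := hodd (InfinitePlace.mk φ)
    rcases exponentAt_eq_or e φ with h | h <;> rw [h]
    · exact ⟨⟨r, hr⟩, by omega, by omega⟩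
    · exact ⟨⟨-r - 1, by rw [hr]; ring⟩, by omega, by omega⟩
  refine traceField_le_of_forall_prod_zpow_mem (cmTypeOf L e hne) (muAlgValueField L ψ)
    (fun φ => (s : ℤ) + (1 - exponentAt e φ) / 2) s (fun φ => ?_) (fun φ => ?_) (fun y => ?_)
  · obtain ⟨⟨r, hr⟩, h1, h2⟩ := hexp φ
    omega
  · rw [mem_cmTypeOf_iff]
    obtain ⟨⟨r, hr⟩, h1, h2⟩ := hexp φ
    omega
  · by_cases hy : y = 0
    · obtain ⟨w⟩ : Nonempty (InfinitePlace L) := inferInstance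
      have hφ : ((memberAt (cmTypeOf L e hne) w).1 : L →+* ℂ) ∈ (cmTypeOf L e hne).1 := (memberAt _ w).2
      rw [mem_cmTypeOf_iff] at hφ
      obtain ⟨⟨r, hr⟩, h1, h2⟩ := hexp (memberAt (cmTypeOf L e hne) w).1
      have hpos : (0 : ℤ) < s + (1 - exponentAt e ((memberAt (cmTypeOf L e hne) w).1 : L →+* ℂ)) / 2 := by
        omega
      rw [Finset.prod_eq_zero (Finset.mem_univ ((memberAt (cmTypeOf L e hne) w).1 : L →+* ℂ))
        (by rw [hy, map_zero, zero_zpow _ hpos.ne'])]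
      exact (muAlgValueField L ψ).zero_mem
    · exact prod_embeddings_zpow_mem_muAlgValueField he hodd s (Units.mk0 y hy)

/-- **[Liu21] §4.1 / Def. 4.3 for a conjugate symplectic `μ` (any weight) with CM type `Φ_μ`: `M'_μ ⊆ M_μ`**
(`M'_μ = traceField Φ_μ`, `M_μ = muAlgValueField`; the ∞-type of a conjugate symplectic `ψ` is odd,
`IsConjugateSymplectic.odd` = Remark 4.2). [cite: Liu2021, §4.1, after Def. 4.3 (TeX l. 1927)] -/
theorem IsConjugateSymplectic.traceField_le_muAlgValueField {ψ : IdeleClassGroup L →ₜ* Circle}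
    (hψ : IsConjugateSymplectic L ψ) {Φ : CMType L} (hΦ : HasCMType L ψ Φ) :
    (traceField Φ).toSubfield ≤ muAlgValueField L ψ := by
  obtain ⟨e, hne, he, rfl⟩ := hΦ
  exact IdeleClassGroup.traceField_le_muAlgValueField_of_odd he (hψ.odd he) hne

/-- **Liu's sentence in full, any weight**: for a conjugate symplectic `μ` with CM type `Φ_μ`, `M'_μ ⊆ M_μ` and
`[M_μ : ℚ] < ∞` — "`M_μ` … is a number field containing `M'_μ`".
[cite: Liu2021, §4.1, after Def. 4.3 (TeX ll. 1926–1927)] -/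
theorem IsConjugateSymplectic.traceField_le_and_finiteDimensional' {ψ : IdeleClassGroup L →ₜ* Circle}
    (hψ : IsConjugateSymplectic L ψ) {Φ : CMType L} (hΦ : HasCMType L ψ Φ) :
    (traceField Φ).toSubfield ≤ muAlgValueField L ψ ∧ FiniteDimensional ℚ (muAlgValueField L ψ) :=
  ⟨hψ.traceField_le_muAlgValueField hΦ, hψ.finiteDimensional_muAlgValueField⟩

end GeneralWeight

end IdeleClassGroup

end Literature.NumberTheory.Automorphic

end
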